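import Summits.CriticalPhenomena.PercolationContinuityZ3.Theorems.PercNearOneGluingNoHeavyLowerTailGZGladkovSP

/-!
# GERM-E on the Wheatstone skeleton, FAN slot (cell level), and Gladkov's inequality at a vertex of the bare bridge

Hub-free bond percolation on the Wheatstone skeleton `a–u, a–v (a₂), u–b (b₁), v–b (b₂), u–v (ρ)` whose FAN slot
`a–u` carries an ARBITRARY finite two-terminal graph `P ∋ x` attached at `a, u` only; `P` enters through the
partition law of `{a,u,x}` in `P`: `τ = P(aux)`, `α = P(ax|u)`, `β = P(ux|a)`, `γ = P(au|x)`
(`θ_P = τ+γ`, `π_a(P) = τ+α`, `π_u(P) = τ+β`, Gladkov margin `M_P = (τ+α)(τ+β) − τ²/(2θ_P)`).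
With the other four edges write `S = a₂(b₂ + (1−b₂)ρb₁)` (a~b surely, i.e. through `a–v` and `{v–b, v–u–b}`),
`C = [b₁ + (1−b₁)(a₂+ρ−a₂ρ)b₂] − S` (the slot is pivotal for a~b), `P_u = a₂(ρ + (1−ρ)b₁b₂)` (a~u off the slot),
`Q_u = b₁ + (1−b₁)ρb₂` (b~u off the slot), `T_u = a₂(b₂(ρ+b₁−ρb₁) + (1−b₂)ρb₁)` (a~b~u off the slot); the composite
`H = W[P]` has (exact enumeration over the 16 states of the other edges, prim-ineq-prove-2 gen 16)
`P(a~x) = τ + α + β·P_u`, `P(b~x) = τ(S+C) + αS + βQ_u`, `P(a~b) = S + C(τ+γ)`, `P(a~b~x) = τS + αS + βT_u + Cτ`.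
**`fan_slot_margin`: `C·M_P ≤ M_H := P(a~x)P(b~x) − P(abx)²/(2P(ab))`.**
Proof: two-class convexity of `u²/v` (`GZGladkovSP.sq_add_div_le`) cancels the piece's own `τ²/θ_P` against `C·τ²/(2θ_P)`,
and `2S·(P(a~x)P(b~x) − C(τ+α)(τ+β)) − (τS+αS+βT_u)²` is a quadratic form in `(τ,α,β)` whose six coefficients are
MANIFESTLY nonnegative: `S²`, `2S²`, `2S·P_u(S+C)`, `S²`, `2S²P_u`, and `2S·P_uQ_u − T_u² = a₂²·K` where `K ≥ 0` is
Gladkov's inequality at the vertex `u` of the triangle-with-tail `{v–b, v–u, u–b}` seen from `(v,b)`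
(`tri_vertex_nonneg`, from the parallel step `GZGladkovSP.margin_parallel_nonneg`) — no Bernstein certificate is needed
(contrast the bridge slot, `GZGladkovW.bridge_slot_margin`).  Together with the series/parallel steps (`GZGladkovSP`) and the
bridge slot this completes, at cell level, the substitution steps of THEOREM K4-G2 (Gladkov's `P(abx)² ≤ 2P(ab)P(ax)P(bx)`
on every two-terminal graph built from edges by series, parallel and Wheatstone-bridge substitution, for every `x`);
`vertex_margin` is the innermost case `x = u` of a bare bridge (piece = the single edge `a–u`), where in print only
arXiv:2408.08457 Thm 6.1 (planar, `a,b,x` on one face) gives the constant `2`.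
-/

namespace Summit.CriticalPhenomena.PercolationContinuityZ3.Theorems

namespace GZGladkovWFan

/-- The pivotality of the fan slot is a sum of nonnegative products:
`C = b₁[(1−a₂) + a₂(1−ρ)(1−b₂)] + (1−b₁)b₂ρ(1−a₂)`. -/
theorem pivotal_eq (a₂ b₁ b₂ ρ : ℝ) :
    (b₁ + (1 - b₁) * (a₂ + ρ - a₂ * ρ) * b₂) - a₂ * (b₂ + (1 - b₂) * ρ * b₁) =
      b₁ * ((1 - a₂) + a₂ * (1 - ρ) * (1 - b₂)) + (1 - b₁) * b₂ * ρ * (1 - a₂) := by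
  ring

/-- Off the slot, `P(b~u) = P(a~b~u) + P(slot pivotal)`: `Q_u = T_u + C`. -/
theorem qu_eq (a₂ b₁ b₂ ρ : ℝ) :
    b₁ + (1 - b₁) * ρ * b₂ =
      a₂ * (b₂ * (ρ + b₁ - ρ * b₁) + (1 - b₂) * ρ * b₁)
        + ((b₁ + (1 - b₁) * (a₂ + ρ - a₂ * ρ) * b₂) - a₂ * (b₂ + (1 - b₂) * ρ * b₁)) := by
  ring

/-- Gladkov's inequality at the vertex `u` of the two-terminal graph `{v–b (b₂), v–u (ρ), u–b (b₁)}` with terminals `v, b`: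
`K = 2·P(v~b)·P(v~u)P(b~u) − P(vbu)² ≥ 0`, from the parallel step applied to the path `v–u–b` (margin `ρb₁/2`) and the
parallel edge `v–b`. -/
theorem tri_vertex_nonneg {b₁ b₂ ρ : ℝ} (hb₁ : 0 < b₁) (hb₁' : b₁ ≤ 1) (hb₂ : 0 ≤ b₂) (hb₂' : b₂ ≤ 1)
    (hρ : 0 < ρ) (hρ' : ρ ≤ 1) :
    0 ≤ 2 * (b₂ + (1 - b₂) * ρ * b₁) * ((ρ + (1 - ρ) * b₁ * b₂) * (b₁ + (1 - b₁) * ρ * b₂))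
      - (b₂ * (ρ + b₁ - ρ * b₁) + (1 - b₂) * ρ * b₁) ^ 2 := by
  -- path v–u–b with x = u: τ = ρb₁, α = ρ(1−b₁), β = (1−ρ)b₁, γ = 0; parallel piece s = b₂
  have hθ : 0 < ρ * b₁ + 0 := by nlinarith [mul_pos hρ hb₁]
  have hM : 0 ≤ (ρ * b₁ + ρ * (1 - b₁)) * (ρ * b₁ + (1 - ρ) * b₁) - (ρ * b₁) ^ 2 / (2 * (ρ * b₁ + 0)) := by
    have e1 : (ρ * b₁ + ρ * (1 - b₁)) * (ρ * b₁ + (1 - ρ) * b₁) - (ρ * b₁) ^ 2 / (2 * (ρ * b₁ + 0))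
        = ρ * b₁ / 2 := by
      field_simp
      ring
    rw [e1]; positivity
  have h := GZGladkovSP.margin_parallel_nonneg (τ := ρ * b₁) (α := ρ * (1 - b₁)) (β := (1 - ρ) * b₁)
    (γ := 0) (s := b₂) (by positivity) (by nlinarith) (by nlinarith) le_rfl (by nlinarith) hb₂ hb₂' hθ hM
  have e2 : ρ * b₁ + 0 + b₂ * (1 - (ρ * b₁ + 0)) = b₂ + (1 - b₂) * ρ * b₁ := by ring
  have e3 : ρ * b₁ + ρ * (1 - b₁) + b₂ * ((1 - ρ) * b₁) = ρ + (1 - ρ) * b₁ * b₂ := by ring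
  have e4 : ρ * b₁ + (1 - ρ) * b₁ + b₂ * (ρ * (1 - b₁)) = b₁ + (1 - b₁) * ρ * b₂ := by ring
  have e5 : ρ * b₁ + b₂ * (ρ * (1 - b₁) + (1 - ρ) * b₁) = b₂ * (ρ + b₁ - ρ * b₁) + (1 - b₂) * ρ * b₁ := by ring
  rw [e2, e3, e4, e5] at h
  have hθ' : 0 < b₂ + (1 - b₂) * ρ * b₁ := by
    have h1 : 0 ≤ 1 - b₂ := by linarith
    have h2 : ρ * b₁ ≤ 1 := by nlinarith
    nlinarith [mul_pos hρ hb₁, mul_nonneg h1 (mul_pos hρ hb₁).le]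
  have h3 : (b₂ * (ρ + b₁ - ρ * b₁) + (1 - b₂) * ρ * b₁) ^ 2 / (2 * (b₂ + (1 - b₂) * ρ * b₁)) ≤
      (ρ + (1 - ρ) * b₁ * b₂) * (b₁ + (1 - b₁) * ρ * b₂) := by
    linarith [h]
  rw [div_le_iff₀ (by positivity)] at h3
  nlinarith [h3]

/-- The polynomial identity behind the fan-slot step, over abstract reals (`P(a~b | slot contracted) = S + C`,
`Q_u = T_u + C`): `2S(π_aπ_b − Cπ_a(P)π_u(P)) − T_sure²` is a quadratic form in `(τ, α, β)` with the displayed coefficients. -/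
theorem quad_identity (S C Pu Tu τ α β : ℝ) :
    2 * S * ((τ + α + β * Pu) * (τ * (S + C) + α * S + β * (Tu + C)) - C * ((τ + α) * (τ + β)))
        - (τ * S + α * S + β * Tu) ^ 2 =
      S ^ 2 * τ ^ 2 + 2 * S ^ 2 * (τ * α) + 2 * S * (Pu * (S + C)) * (τ * β)
        + S ^ 2 * α ^ 2 + 2 * S ^ 2 * Pu * (α * β) + (2 * S * (Pu * (Tu + C)) - Tu ^ 2) * β ^ 2 := by
  ring

/-- **GERM-E on the Wheatstone skeleton, fan slot** (cell level).  For other-edge weights in `(0,1)` and piece partition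
masses `τ, α, β, γ ≥ 0` with `θ_P = τ + γ > 0`:  `C·((τ+α)(τ+β) − τ²/(2θ_P)) ≤ P(a~x)P(b~x) − P(abx)²/(2P(ab))` for the
composite `W[P]` (cells as in the module docstring), i.e. `C · M_P ≤ M_H`. -/
theorem fan_slot_margin {a₂ b₁ b₂ ρ τ α β γ : ℝ} (ha₂ : 0 < a₂) (ha₂' : a₂ < 1) (hb₁ : 0 < b₁) (hb₁' : b₁ < 1)
    (hb₂ : 0 < b₂) (hb₂' : b₂ < 1) (hρ : 0 < ρ) (hρ' : ρ < 1) (hτ : 0 ≤ τ) (hα : 0 ≤ α) (hβ : 0 ≤ β)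
    (_hγ : 0 ≤ γ) (hθ : 0 < τ + γ) :
    ((b₁ + (1 - b₁) * (a₂ + ρ - a₂ * ρ) * b₂) - a₂ * (b₂ + (1 - b₂) * ρ * b₁))
        * ((τ + α) * (τ + β) - τ ^ 2 / (2 * (τ + γ))) ≤
      (τ + α + β * (a₂ * (ρ + (1 - ρ) * b₁ * b₂)))
          * (τ * (b₁ + (1 - b₁) * (a₂ + ρ - a₂ * ρ) * b₂) + α * (a₂ * (b₂ + (1 - b₂) * ρ * b₁))
              + β * (b₁ + (1 - b₁) * ρ * b₂))
        - ((τ * (a₂ * (b₂ + (1 - b₂) * ρ * b₁)) + α * (a₂ * (b₂ + (1 - b₂) * ρ * b₁))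
              + β * (a₂ * (b₂ * (ρ + b₁ - ρ * b₁) + (1 - b₂) * ρ * b₁)))
            + ((b₁ + (1 - b₁) * (a₂ + ρ - a₂ * ρ) * b₂) - a₂ * (b₂ + (1 - b₂) * ρ * b₁)) * τ) ^ 2
          / (2 * (a₂ * (b₂ + (1 - b₂) * ρ * b₁)
              + ((b₁ + (1 - b₁) * (a₂ + ρ - a₂ * ρ) * b₂) - a₂ * (b₂ + (1 - b₂) * ρ * b₁)) * (τ + γ))) := by
  have h2a : 0 < 1 - a₂ := by linarith
  have h1b : 0 < 1 - b₁ := by linarith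
  have h2b : 0 < 1 - b₂ := by linarith
  have hr : 0 < 1 - ρ := by linarith
  have hS : 0 < a₂ * (b₂ + (1 - b₂) * ρ * b₁) := by positivity
  have hC : 0 < (b₁ + (1 - b₁) * (a₂ + ρ - a₂ * ρ) * b₂) - a₂ * (b₂ + (1 - b₂) * ρ * b₁) := by
    rw [pivotal_eq]; positivity
  have hPu : 0 ≤ a₂ * (ρ + (1 - ρ) * b₁ * b₂) := by positivity
  -- coefficient facts with explicit polynomials
  have hK := tri_vertex_nonneg hb₁ hb₁'.le hb₂.le hb₂'.le hρ hρ'.le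
  have hbb : 0 ≤ 2 * (a₂ * (b₂ + (1 - b₂) * ρ * b₁)) * ((a₂ * (ρ + (1 - ρ) * b₁ * b₂)) * (b₁ + (1 - b₁) * ρ * b₂))
      - (a₂ * (b₂ * (ρ + b₁ - ρ * b₁) + (1 - b₂) * ρ * b₁)) ^ 2 := by
    have e : 2 * (a₂ * (b₂ + (1 - b₂) * ρ * b₁)) * ((a₂ * (ρ + (1 - ρ) * b₁ * b₂)) * (b₁ + (1 - b₁) * ρ * b₂))
        - (a₂ * (b₂ * (ρ + b₁ - ρ * b₁) + (1 - b₂) * ρ * b₁)) ^ 2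
        = a₂ ^ 2 * (2 * (b₂ + (1 - b₂) * ρ * b₁) * ((ρ + (1 - ρ) * b₁ * b₂) * (b₁ + (1 - b₁) * ρ * b₂))
            - (b₂ * (ρ + b₁ - ρ * b₁) + (1 - b₂) * ρ * b₁) ^ 2) := by
      ring
    rw [e]; positivity
  have hQu := qu_eq a₂ b₁ b₂ ρ
  -- make the structured quantities opaque
  set S := a₂ * (b₂ + (1 - b₂) * ρ * b₁) with hSdef
  set C := (b₁ + (1 - b₁) * (a₂ + ρ - a₂ * ρ) * b₂) - S with hCdef
  set Pu := a₂ * (ρ + (1 - ρ) * b₁ * b₂) with hPudef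
  set Tu := a₂ * (b₂ * (ρ + b₁ - ρ * b₁) + (1 - b₂) * ρ * b₁) with hTudef
  have ePball : (b₁ + (1 - b₁) * (a₂ + ρ - a₂ * ρ) * b₂) = S + C := by rw [hCdef]; ring
  rw [hQu, ePball]
  rw [hQu] at hbb
  clear_value S C Pu Tu
  clear hSdef hCdef hPudef hTudef hQu ePball
  -- (1) two-class convexity
  have hconv := GZGladkovSP.sq_add_div_le (u₁ := τ * S + α * S + β * Tu) (u₂ := C * τ) (v₁ := 2 * S)
    (v₂ := 2 * (C * (τ + γ))) (by positivity) (by positivity)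
  have e1 : 2 * S + 2 * (C * (τ + γ)) = 2 * (S + C * (τ + γ)) := by ring
  have e2 : (C * τ) ^ 2 / (2 * (C * (τ + γ))) = C * (τ ^ 2 / (2 * (τ + γ))) := by
    field_simp
  rw [e1, e2] at hconv
  -- (2) the quadratic form
  have hid := quad_identity S C Pu Tu τ α β
  have hQ : (τ * S + α * S + β * Tu) ^ 2 ≤
      2 * S * ((τ + α + β * Pu) * (τ * (S + C) + α * S + β * (Tu + C)) - C * ((τ + α) * (τ + β))) := by
    nlinarith [hid, hbb, mul_nonneg (mul_nonneg hτ hα) (sq_nonneg S), mul_nonneg (mul_nonneg hτ hβ) (mul_nonneg hS.le (mul_nonneg hPu (add_nonneg hS.le hC.le))),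
      mul_nonneg (mul_nonneg hα hβ) (mul_nonneg (sq_nonneg S) hPu), mul_nonneg hbb (sq_nonneg β),
      mul_nonneg (sq_nonneg S) (sq_nonneg τ), mul_nonneg (sq_nonneg S) (sq_nonneg α)]
  have hQ' : (τ * S + α * S + β * Tu) ^ 2 / (2 * S) ≤
      (τ + α + β * Pu) * (τ * (S + C) + α * S + β * (Tu + C)) - C * ((τ + α) * (τ + β)) := by
    rw [div_le_iff₀ (by positivity)]; linarith [hQ]
  have e3 : C * ((τ + α) * (τ + β) - τ ^ 2 / (2 * (τ + γ))) =
      C * ((τ + α) * (τ + β)) - C * (τ ^ 2 / (2 * (τ + γ))) := by ring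
  rw [e3]
  linarith [hconv, hQ']

/-- **Gladkov's inequality with constant 2 at an internal vertex of the bare Wheatstone bridge** (cell level): for
`W = {a–u (a₁), a–v (a₂), u–b (b₁), v–b (b₂), u–v (ρ)}` with weights in `(0,1)` and `x = u`,
`P(a~b~u)² ≤ 2·P(a~b)·P(a~u)·P(b~u)`, in the sharper form `C·a₁/2 ≤ P(a~u)P(b~u) − P(abu)²/(2P(ab))`
(= `fan_slot_margin` for the piece `P` = the single edge `a–u`: `τ = a₁, α = 0, β = 1−a₁, γ = 0`, `M_P = a₁/2`).
Cells: `P(a~u) = a₁ + (1−a₁)P_u`, `P(b~u) = a₁(S+C) + (1−a₁)Q_u`, `P(a~b) = S + Ca₁`, `P(a~b~u) = a₁S + (1−a₁)T_u + Ca₁`. -/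
theorem vertex_margin {a₁ a₂ b₁ b₂ ρ : ℝ} (ha₁ : 0 < a₁) (ha₁' : a₁ < 1) (ha₂ : 0 < a₂) (ha₂' : a₂ < 1)
    (hb₁ : 0 < b₁) (hb₁' : b₁ < 1) (hb₂ : 0 < b₂) (hb₂' : b₂ < 1) (hρ : 0 < ρ) (hρ' : ρ < 1) :
    ((b₁ + (1 - b₁) * (a₂ + ρ - a₂ * ρ) * b₂) - a₂ * (b₂ + (1 - b₂) * ρ * b₁)) * (a₁ / 2) ≤
      (a₁ + (1 - a₁) * (a₂ * (ρ + (1 - ρ) * b₁ * b₂)))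
          * (a₁ * (b₁ + (1 - b₁) * (a₂ + ρ - a₂ * ρ) * b₂) + (1 - a₁) * (b₁ + (1 - b₁) * ρ * b₂))
        - (a₁ * (a₂ * (b₂ + (1 - b₂) * ρ * b₁))
              + (1 - a₁) * (a₂ * (b₂ * (ρ + b₁ - ρ * b₁) + (1 - b₂) * ρ * b₁))
              + ((b₁ + (1 - b₁) * (a₂ + ρ - a₂ * ρ) * b₂) - a₂ * (b₂ + (1 - b₂) * ρ * b₁)) * a₁) ^ 2
          / (2 * (a₂ * (b₂ + (1 - b₂) * ρ * b₁)
              + ((b₁ + (1 - b₁) * (a₂ + ρ - a₂ * ρ) * b₂) - a₂ * (b₂ + (1 - b₂) * ρ * b₁)) * a₁)) := by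
  have h := fan_slot_margin (τ := a₁) (α := 0) (β := 1 - a₁) (γ := 0) ha₂ ha₂' hb₁ hb₁' hb₂ hb₂' hρ hρ'
    ha₁.le le_rfl (by linarith) le_rfl (by linarith)
  have e1 : (a₁ + 0) * (a₁ + (1 - a₁)) - a₁ ^ 2 / (2 * (a₁ + 0)) = a₁ / 2 := by
    field_simp
    ring
  rw [e1] at h
  have e2 : a₁ + 0 + (1 - a₁) * (a₂ * (ρ + (1 - ρ) * b₁ * b₂)) = a₁ + (1 - a₁) * (a₂ * (ρ + (1 - ρ) * b₁ * b₂)) := by ring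
  have e3 : a₁ * (b₁ + (1 - b₁) * (a₂ + ρ - a₂ * ρ) * b₂) + 0 * (a₂ * (b₂ + (1 - b₂) * ρ * b₁))
      + (1 - a₁) * (b₁ + (1 - b₁) * ρ * b₂)
      = a₁ * (b₁ + (1 - b₁) * (a₂ + ρ - a₂ * ρ) * b₂) + (1 - a₁) * (b₁ + (1 - b₁) * ρ * b₂) := by ring
  have e4 : a₁ * (a₂ * (b₂ + (1 - b₂) * ρ * b₁)) + 0 * (a₂ * (b₂ + (1 - b₂) * ρ * b₁))
      + (1 - a₁) * (a₂ * (b₂ * (ρ + b₁ - ρ * b₁) + (1 - b₂) * ρ * b₁))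
      = a₁ * (a₂ * (b₂ + (1 - b₂) * ρ * b₁))
        + (1 - a₁) * (a₂ * (b₂ * (ρ + b₁ - ρ * b₁) + (1 - b₂) * ρ * b₁)) := by ring
  have e5 : (a₁ + (0 : ℝ)) = a₁ := by ring
  rw [e2, e3, e4, e5] at h
  exact h

end GZGladkovWFan

end Summit.CriticalPhenomena.PercolationContinuityZ3.Theorems
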